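import Literature.AlgebraicGeometry.HodgeTheory.HodgeGenericQbarDescent
import Literature.AlgebraicGeometry.HodgeTheory.MotivatedClassesDeformationInputs
import Literature.AlgebraicGeometry.Motives.BaseChangeProofs
import Literature.AlgebraicGeometry.Motives.BaseChangePointsOverProofs
import Literature.AlgebraicGeometry.Motives.AbelianVarietyProofs
import Literature.AlgebraicGeometry.Resolution.SmoothStalksRegular
import Literature.AlgebraicGeometry.Motives.GoodReductionSpecialFibreProofs
import Literature.NumberTheory.Transcendental.AnalytificationConnected
import HarnessLib

/-!
# Voisin 2007, Prop. 0.7: "a smooth compactification, which we may assume defined over `ℚ̄`" — the bookkeeping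

Family `hodge`, layer `Literature/AlgebraicGeometry/HodgeTheory`. Proof file (sorry-free, theorems
only, no named fact introduced) serving the unit `voisin2007_algebraic_of_finite_monodromyOrbit_of_qbar`
(`HodgeGenericQbarDescent.lean`; C. Voisin, *Hodge loci and absolute Hodge classes*, Compositio
Math. 143 (2007), Prop. 0.7 = arXiv math/0605766 Prop. 1.7, proof at the end of §3: "Thus we have by
base change a family `π'' : 𝒳_{S''} → S''` […] a smooth compactification `𝒳̄_{S''}`, which we may
assume defined over `ℚ̄`").

Main result: `exists_smoothProjective_baseChangeHom_compactification_familyPullback` — for a family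
`f₀ : 𝒳₀ ⟶ S₀` of quasi-projective `ℚ̄`-schemes whose complexification along `σ : ℚ̄ →+* ℂ` is a
smooth projective family, `S₀` smooth, and a finite étale `g₀ : S''₀ ⟶ S₀` with `S''₀`
quasi-projective and `S''(ℂ)` connected, the complex family `𝒳_σ ×_{S_σ} S''_σ` embeds openly into
`X̄₀ ⊗_σ ℂ` for a smooth projective `ℚ̄`-scheme `X̄₀` — GRANTED two classical theorems taken as
hypotheses in citable shape: `hFinQP` (a scheme finite over a quasi-projective `ℚ̄`-scheme is
quasi-projective: EGA II Cor. 6.1.11 with Prop. 5.3.4 (ii)) and `hHir` (Hironaka 1964, Main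
Theorem I over `ℚ̄`: a smooth quasi-projective irreducible `ℚ̄`-scheme of pure dimension `m` is an
open subscheme of a smooth projective one — the `ℚ̄`-instance of the shape of the tree's named fact
`Hironaka1964_smoothCompactification`, which is the `ℂ`-instance). This is the hypothesis `hComp`
of `voisin2007_algebraic_of_finite_monodromyOrbit_of_qbar_of_inputs`
(`HodgeGenericQbarDescentFiniteMonodromyProofs.lean`) reduced to Hironaka.

PROVED here (what "we may assume defined over `ℚ̄`" costs on the tree's carriers):

* `smooth_of_smooth_baseChangeHom_map_left` — smoothness of a `K`-morphism descends from its base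
  change to `L` (faithfully flat descent, EGA IV 17.7.3 (ii), through Mathlib's
  `DescendsAlong @Smooth (@Surjective ⊓ @Flat ⊓ @QuasiCompact)` and the cartesian square
  `Motives.isPullback_baseChange_map_left`);
* `exists_familyPullback_iso_baseChangeHom_obj` — `(𝒳 ×_S S')_σ ≅ 𝒳_σ ×_{S_σ} S'_σ` compatibly with
  the projections (`baseChangeHom σ = Over.pullback` is a right adjoint);
* `irreducibleSpace_of_irreducibleSpace_baseChangeHom_obj` (irreducibility descends along the
  surjection `X_σ ⟶ X`), `irreducibleSpace_left_of_connectedSpace_complexPoints` (a smooth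
  `ℂ`-scheme with connected complex points is irreducible: SGA1 XII Prop. 2.4 + Stacks 056S +
  Görtz–Wedhorn I Ex. 3.16), `surjective_baseChangeHomFst`, `isOpenImmersion_baseChangeHom_map_left`.

## References

* [Voisin2007HodgeLoci] C. Voisin, Hodge loci and absolute Hodge classes, Compositio Math. 143
  (2007), §3, proof of Prop. 0.7 (arXiv math/0605766: Prop. 1.7, p. 7).
* [Hironaka1964] H. Hironaka, Resolution of singularities of an algebraic variety over a field of
  characteristic zero, Ann. of Math. 79 (1964), Main Theorem I.
* [EGAII] A. Grothendieck, Éléments de géométrie algébrique II, Publ. Math. IHÉS 8 (1961),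
  Prop. 5.3.4 (ii), Cor. 6.1.11.
* [EGAIV4] A. Grothendieck, Éléments de géométrie algébrique IV₄, Publ. Math. IHÉS 32 (1967),
  Prop. 17.7.3 (ii).
* [Liu2002] Q. Liu, Algebraic Geometry and Arithmetic Curves, Rem. 3.1.20, Prop. 3.1.23,
  Ch. 4 Prop. 3.8.
* [SGA1] A. Grothendieck, M. Raynaud, SGA 1 (arXiv:math/0206203), Exp. XII Prop. 2.4.
* [StacksProject] The Stacks Project, Tag 056S.
* [GortzWedhorn2020] U. Görtz, T. Wedhorn, Algebraic Geometry I (2nd ed.), Exercise 3.16.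
-/

noncomputable section

open CategoryTheory CategoryTheory.Limits AlgebraicGeometry
open _root_.Topology

namespace Literature.AlgebraicGeometry.HodgeTheory

section BaseChangeFamily

universe u

variable {K L : Type u} [Field K] [Field L] (σ : K →+* L)

/-- The projection `X_σ ⟶ X` is surjective: it is the base change of `Spec L ⟶ Spec K`, which is
surjective as both spectra are points (cf. `Resolution.DeJong1996.Stage.surjective_specMap`,
`Motives.surjective_specMap_of_field`, not imported here to keep the import closure small).
[folklore] -/
theorem surjective_baseChangeHomFst (X : Motives.SchemeOver K) :
    Surjective (Motives.baseChangeHomFst σ X) := by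
  haveI : Surjective (Spec.map (CommRingCat.ofHom σ)) := by
    haveI : Subsingleton ↥(Spec (CommRingCat.of K)) :=
      inferInstanceAs (Subsingleton (PrimeSpectrum K))
    exact ⟨fun x ↦ ⟨(default : ↥(Spec (CommRingCat.of L))), Subsingleton.elim _ _⟩⟩
  exact MorphismProperty.pullback_fst (P := @Surjective) _ _ ‹_›

/-- **Smoothness descends along extension of the base field** (faithfully flat descent,
EGA IV 17.7.3; Mathlib `DescendsAlong @Smooth (@Surjective ⊓ @Flat ⊓ @QuasiCompact)` applied to the
cartesian square `X_σ ⟶ Y_σ` over `X ⟶ Y`, `Motives.isPullback_baseChange_map_left`): a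
`K`-morphism whose base change to `L` is smooth is smooth. [folklore] -/
theorem smooth_of_smooth_baseChangeHom_map_left {X Y : Motives.SchemeOver K} (f : X ⟶ Y)
    [Smooth ((Motives.baseChangeHom σ).map f).left] : Smooth f.left := by
  letI := σ.toAlgebra
  have hsq := Motives.isPullback_baseChange_map_left L f
  have hQ : (@Surjective ⊓ @Flat ⊓ @QuasiCompact : MorphismProperty Scheme)
      (Motives.baseChangeHomFst σ Y) :=
    ⟨⟨surjective_baseChangeHomFst σ Y, inferInstance⟩,
      Motives.FinitePointsOver.quasiCompact_baseChangeHomFst σ Y⟩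
  exact MorphismProperty.of_isPullback_of_descendsAlong (P := @Smooth)
    (Q := @Surjective ⊓ @Flat ⊓ @QuasiCompact) hsq hQ ‹_›

/-- Open immersions are stable under extension of the base field along `σ`. [folklore] -/
theorem isOpenImmersion_baseChangeHom_map_left {X Y : Motives.SchemeOver K} (j : X ⟶ Y)
    [IsOpenImmersion j.left] : IsOpenImmersion ((Motives.baseChangeHom σ).map j).left := by
  letI := σ.toAlgebra
  exact MorphismProperty.IsStableUnderBaseChange.of_isPullback
    (Motives.isPullback_baseChange_map_left L j).flip ‹IsOpenImmersion j.left›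

/-- `baseChangeHom σ` is a right adjoint (it is `Over.pullback`, Mathlib `Over.mapPullbackAdj`),
hence preserves fibre products; stated as a theorem, use with `haveI`. [folklore] -/
theorem isRightAdjoint_baseChangeHom : (Motives.baseChangeHom σ).IsRightAdjoint := by
  change (Over.pullback _).IsRightAdjoint
  infer_instance

/-- **Base change of families commutes with extension of the base field**:
`𝒳_σ ×_{S_σ} S'_σ ≅ (𝒳 ×_S S')_σ` over `L`, compatibly with the two projections (both are fibre
products of `f_σ` and `g_σ`, since `baseChangeHom σ = Over.pullback` is a right adjoint;
`X ×_S S' = X ×_Y (Y ×_S S')`). [cite: Liu2002, Rem. 3.1.20] -/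
theorem exists_familyPullback_iso_baseChangeHom_obj {𝒳 S S' : Motives.SchemeOver K} (f : 𝒳 ⟶ S)
    (g : S' ⟶ S) :
    ∃ e : Motives.familyPullback ((Motives.baseChangeHom σ).map f) ((Motives.baseChangeHom σ).map g) ≅
        (Motives.baseChangeHom σ).obj (Motives.familyPullback f g),
      e.hom ≫ (Motives.baseChangeHom σ).map (Motives.familyPullback.fst f g) =
          Motives.familyPullback.fst _ _ ∧
        e.hom ≫ (Motives.baseChangeHom σ).map (Motives.familyPullback.snd f g) =
          Motives.familyPullback.snd _ _ := by
  haveI := isRightAdjoint_baseChangeHom σ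
  have h₁ := Motives.familyPullback.isPullback ((Motives.baseChangeHom σ).map f)
    ((Motives.baseChangeHom σ).map g)
  have h₂ := (Motives.familyPullback.isPullback f g).map (Motives.baseChangeHom σ)
  exact ⟨h₁.isoIsPullback _ _ h₂, h₁.isoIsPullback_hom_fst _ _ h₂, h₁.isoIsPullback_hom_snd _ _ h₂⟩

/-- Irreducibility descends along `X_σ ⟶ X` (a continuous surjection). [folklore] -/
theorem irreducibleSpace_of_irreducibleSpace_baseChangeHom_obj (X : Motives.SchemeOver K)
    [IrreducibleSpace ((Motives.baseChangeHom σ).obj X).left] : IrreducibleSpace X.left :=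
  (surjective_baseChangeHomFst σ X).surj.irreducibleSpace
    (Motives.baseChangeHomFst σ X).continuous

end BaseChangeFamily

section SmoothIrreducible

open Literature.AlgebraicGeometry.Motives

/-- A smooth `ℂ`-scheme with connected space of complex points is irreducible (closed points are
dense, SGA1 XII Prop. 2.4, so the scheme is connected, `ComplexPoints.connectedSpace_left_of_connectedSpace`;
its local rings are domains, Stacks 056S, `Resolution.isDomain_stalk_of_smooth`; so it is
irreducible, Görtz–Wedhorn I Ex. 3.16, `irreducibleSpace_of_isDomain_stalk`); cf.
`Motives.geometricallyIrreducible_of_connectedSpace_complexPoints` (pure-dimensional case).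
[cite: SGA1, Exp. XII Prop. 2.4] [cite: StacksProject, Tag 056S] [cite: GortzWedhorn2020, Exercise 3.16] -/
theorem irreducibleSpace_left_of_connectedSpace_complexPoints {Y : SchemeOver ℂ}
    [Smooth Y.hom] [ConnectedSpace (ComplexPoints Y)] : IrreducibleSpace Y.left := by
  haveI : LocallyOfFiniteType Y.hom := inferInstance
  haveI : ConnectedSpace Y.left := ComplexPoints.connectedSpace_left_of_connectedSpace (X := Y)
  haveI : IsLocallyNoetherian Y.left := LocallyOfFiniteType.isLocallyNoetherian Y.hom
  exact irreducibleSpace_of_isDomain_stalk Y.left fun x ↦ Resolution.isDomain_stalk_of_smooth Y.hom x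

end SmoothIrreducible

section Compactification

open Literature.AlgebraicGeometry.Motives

/-- **The compactification input `hComp` of
`voisin2007_algebraic_of_finite_monodromyOrbit_of_qbar_of_inputs` from Hironaka over `ℚ̄`.**
Granted (i) that a scheme finite over a quasi-projective `ℚ̄`-scheme is quasi-projective
(`hFinQP`: EGA II Cor. 6.1.11 with Prop. 5.3.4 (ii)) and (ii) Hironaka's smooth projective
compactification of smooth quasi-projective irreducible `ℚ̄`-schemes of pure dimension (`hHir`:
Main Theorem I over the field `ℚ̄` of characteristic zero — the `ℚ̄`-instance of the shape of the
tree's named fact `Hironaka1964_smoothCompactification`, which is its `ℂ`-instance), the complex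
base change `𝒳_σ ×_{S_σ} S''_σ` of a family `f₀ : 𝒳₀ ⟶ S₀` over `ℚ̄` with smooth projective
complexification, along a finite étale `g₀ : S''₀ ⟶ S₀` with `S''(ℂ)` connected, embeds openly into
`X̄₀ ⊗_σ ℂ` for a smooth projective `ℚ̄`-scheme `X̄₀` ("a smooth compactification `𝒳̄_{S''}`, which
we may assume defined over `ℚ̄`"). PROVED here, i.e. what "we may assume defined over `ℚ̄`" costs
on the tree's carriers: `(𝒳 ×_S S'')_σ ≅ 𝒳_σ ×_{S_σ} S''_σ` (`exists_familyPullback_iso_baseChangeHom_obj`);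
smoothness of `𝒳₀ → S₀` by faithfully flat descent from `ℂ` (`smooth_of_smooth_baseChangeHom_map_left`);
irreducibility of `𝒳₀ ×_{S₀} S''₀` (the complex family over the smooth base `S''_σ` with connected
complex points has irreducible total space, `irreducibleSpace_of_isSmoothProjectiveFamily`, and
irreducibility descends along the surjection `X_σ → X`); its pure dimension
(`Motives.exists_smoothOfRelativeDimension_of_smooth`).
[cite: Voisin2007HodgeLoci, §3, proof of Prop. 1.7] [cite: Hironaka1964, Main Theorem I]
[cite: Liu2002, Rem. 3.1.20] -/
theorem exists_smoothProjective_baseChangeHom_compactification_familyPullback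
    (hFinQP : ∀ ⦃X Y : SchemeOver (AlgebraicClosure ℚ)⦄ (h : X ⟶ Y), IsFinite h.left →
      IsQuasiProjectiveOver Y → IsQuasiProjectiveOver X)
    (hHir : ∀ (m : ℕ) (X : SchemeOver (AlgebraicClosure ℚ)), SmoothOfRelativeDimension m X.hom →
      IsQuasiProjectiveOver X → IrreducibleSpace X.left →
      ∃ (Xbar : SchemeOver (AlgebraicClosure ℚ)) (i : X ⟶ Xbar),
        IsSmoothProjective m Xbar ∧ IsOpenImmersion i.left)
    (σ : AlgebraicClosure ℚ →+* ℂ) ⦃𝒳₀ S₀ S''₀ : SchemeOver (AlgebraicClosure ℚ)⦄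
    (f₀ : 𝒳₀ ⟶ S₀) (g₀ : S''₀ ⟶ S₀) (n : ℕ) (h𝒳₀ : IsQuasiProjectiveOver 𝒳₀)
    (hS''₀ : IsQuasiProjectiveOver S''₀) (hS₀sm : AlgebraicGeometry.Smooth S₀.hom)
    (hfin : IsFinite g₀.left) (het : Etale g₀.left)
    (hconn : ConnectedSpace (ComplexPoints ((baseChangeHom σ).obj S''₀)))
    (hf : IsSmoothProjectiveFamily ((baseChangeHom σ).map f₀) n) :
    ∃ (m : ℕ) (Xbar₀ : SchemeOver (AlgebraicClosure ℚ))
      (i : familyPullback ((baseChangeHom σ).map f₀) ((baseChangeHom σ).map g₀) ⟶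
        (baseChangeHom σ).obj Xbar₀),
      IsSmoothProjective m Xbar₀ ∧ IsOpenImmersion i.left := by
  haveI := hfin
  haveI := het
  haveI := hS₀sm
  haveI := hconn
  set X₀ : SchemeOver (AlgebraicClosure ℚ) := familyPullback f₀ g₀ with hX₀
  -- (1) `X₀ = 𝒳₀ ×_{S₀} S''₀` is quasi-projective: it is finite over `𝒳₀`
  have hX₀qp : IsQuasiProjectiveOver X₀ :=
    hFinQP (familyPullback.fst f₀ g₀)
      (by
        change IsFinite (pullback.fst f₀.left g₀.left)
        exact MorphismProperty.pullback_fst (P := @IsFinite) _ _ hfin) h𝒳₀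
  -- (2) `X₀ → Spec ℚ̄` is smooth: `𝒳₀ → S₀` is smooth by descent from `ℂ`, `S₀` is smooth, and
  -- `X₀ → 𝒳₀` is étale
  haveI : Smooth ((baseChangeHom σ).map f₀).left := hf.smooth
  haveI : Smooth f₀.left := smooth_of_smooth_baseChangeHom_map_left σ f₀
  haveI : Smooth 𝒳₀.hom := by
    rw [← Over.w f₀]
    infer_instance
  haveI : Smooth X₀.hom := by
    change Smooth (pullback.fst f₀.left g₀.left ≫ 𝒳₀.hom)
    infer_instance
  -- (3) `X₀` is irreducible: `X₀ ⊗_σ ℂ ≅ 𝒳_σ ×_{S_σ} S''_σ` is the total space of a smooth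
  -- projective family over the smooth base `S''_σ`, which has connected complex points
  set g : (baseChangeHom σ).obj S''₀ ⟶ (baseChangeHom σ).obj S₀ := (baseChangeHom σ).map g₀
    with hg
  have hS'' : IsQuasiProjectiveOver ((baseChangeHom σ).obj S''₀) := by
    letI := σ.toAlgebra
    obtain ⟨P, j, hP, hj⟩ := hS''₀
    haveI := hj
    refine ⟨(Motives.baseChange _ ℂ).obj P, (Motives.baseChange _ ℂ).map j, hP.baseChange_obj ℂ,
      ?_⟩
    exact MorphismProperty.IsStableUnderBaseChange.of_isPullback
      (Motives.isPullback_baseChange_map_left ℂ j).flip hj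
  haveI : LocallyOfFiniteType ((baseChangeHom σ).obj S''₀).hom := hS''.locallyOfFiniteType
  haveI : Smooth ((baseChangeHom σ).obj S₀).hom := by
    change Smooth (pullback.snd S₀.hom _)
    infer_instance
  haveI : Etale g.left := by
    letI := σ.toAlgebra
    exact MorphismProperty.IsStableUnderBaseChange.of_isPullback
      (Motives.isPullback_baseChange_map_left ℂ g₀).flip ‹Etale g₀.left›
  haveI : Smooth ((baseChangeHom σ).obj S''₀).hom := by
    rw [← Over.w g]
    infer_instance
  haveI : IrreducibleSpace ((baseChangeHom σ).obj S''₀).left :=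
    irreducibleSpace_left_of_connectedSpace_complexPoints
  haveI : IrreducibleSpace (familyPullback ((baseChangeHom σ).map f₀) g).left :=
    irreducibleSpace_of_isSmoothProjectiveFamily _ (hf.familyPullback_snd g)
  obtain ⟨e, -, -⟩ := exists_familyPullback_iso_baseChangeHom_obj σ f₀ g₀
  set e' : (familyPullback ((baseChangeHom σ).map f₀) g).left ≅ ((baseChangeHom σ).obj X₀).left :=
    (Over.forget _).mapIso e with he'
  haveI : IrreducibleSpace ((baseChangeHom σ).obj X₀).left :=
    (Scheme.homeoOfIso e').surjective.irreducibleSpace (Scheme.homeoOfIso e').continuous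
  haveI : IrreducibleSpace X₀.left := irreducibleSpace_of_irreducibleSpace_baseChangeHom_obj σ X₀
  -- (4) pure dimension and Hironaka over `ℚ̄`
  obtain ⟨m, hm⟩ := exists_smoothOfRelativeDimension_of_smooth X₀.hom
  obtain ⟨Xbar₀, i₀, hXbar₀, hi₀⟩ := hHir m X₀ hm hX₀qp inferInstance
  haveI := hi₀
  refine ⟨m, Xbar₀, e.hom ≫ (baseChangeHom σ).map i₀, hXbar₀, ?_⟩
  haveI := isOpenImmersion_baseChangeHom_map_left σ i₀
  haveI : IsOpenImmersion e.hom.left :=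
    (inferInstance : IsOpenImmersion ((Over.forget _).mapIso e).hom)
  rw [Over.comp_left]
  infer_instance

end Compactification

end Literature.AlgebraicGeometry.HodgeTheory

end
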